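/-
Copyright (c) 2026 the pub-hodgecm-mathlib formalisation cell (harness21).  Prover seat hodgecm-mathlib-K2E3-p01 (g0), Track B ∕ K2-LIT
(build stream 29), h413 = `stmt-HodgeConjecture-24833`, line `K2_E3_EllipticInputs`, unit U3, line U3-d (lead K2E3-p03): FILE A of the ‹Ψ-package›
(DEAL SPEC K2/STATUS.md 2026-09-03T22:29:11Z) — part 3, the properties (E)(Z)(R)(C)(T)(S) of the Cayley scaling on the model `U(σ, J)(K)`.  2026-09-03.
-/
import Summits.HodgeConjecture.HodgeConjecture.Theorems.K2E3CayleyScalingModel   -- ★ part 2 (this seat): the eigenvalue ball `B` (`hB`), `isUnit_of_mem_ball`, `isOpen_ball`, `isClosed_ball`, `conj_mem_ball`, continuity kit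
import Literature.NumberTheory.Rogawski1990.LocalTransferFundamentalLemma         -- ★ `IsLocSmooth` (`C_c^∞`: locally constant, compact support)
import HarnessLib

/-!
# h413 ∕ Track B «K2-LIT», line `K2_E3_EllipticInputs`, unit U3, line U3-d: THE CAYLEY SCALING `Ψ_s = c ∘ (s·) ∘ c⁻¹` ON THE EIGENVALUE BALL OF `U(σ, J)(K)` IS EQUIVARIANT,
# CENTRALISER-PRESERVING, REGULARITY-PRESERVING, CONTRACTING, CONTINUOUS, AND CARRIES `C_c^∞` TO `C_c^∞` (‹Ψ-package› FILE A, part 3)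

Cell `pub/hodgecm-mathlib`, crux H413 = `stmt-HodgeConjecture-24833`, route of record `HCCMUnconditional`; chair K2-lead (g0), dealer K2E3-plan (g1), line lead of U3-d
K2E3-p03 (g0).  THEOREMS ONLY (no `def`, no `instance`, no `notation`, no named-fact hypothesis, no `sorry`); imports = ★ + HarnessLib; lane
`--supports stmt-HodgeConjecture-24833 --as helper` (count-neutral).

DESIGN (no definitions, as in part 2).  `K` an ultrametric normed field, `σ`, `J ∈ M₃(K)`, `M = U(σ, J)(K)`, `X_u = (g − 1)(g + 1)⁻¹`; the ball `B` of radius `ρ` is a variable with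
`hB : u ∈ B ↔ det(g + 1) ∈ Kˣ ∧ ‖c₂(χ_{X_u})‖ ≤ ρ ∧ ‖c₁‖ ≤ ρ² ∧ ‖c₀‖ ≤ ρ³`, and THE CAYLEY SCALING is a variable `Ψ : M → M` with
`hΨ : ∀ u ∈ B, mat(Ψ u) = c(s•X_u) ∧ mat((Ψ u)⁻¹) = c(−s•X_u)` (it exists: ★ part 2 `exists_cayleyScaling`).  Standing hypotheses where needed: `2 ≠ 0`, `s ≠ 0`, `‖s‖ ≤ 1`
(resp. `< 1` for (T)), `0 < ρ < 1`.

RESULTS ([PlatonovRapinchuk1994] §3.3; [HarishChandra1999] §3.1 Lemma 3.2; [Rogawski1990] §8.1 Prop. 8.1.2 (b) p. 114, (8.1.1) p. 116).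
* (E) `cayleyScaling_conj` — `Ψ(x u x⁻¹) = x Ψ(u) x⁻¹` (`c`, `c⁻¹` are conjugation-equivariant, ★ part 1).
* (Z) `comm_iff_comm_cayleyScaling` — `z u = u z ⟺ z Ψ(u) = Ψ(u) z` (commuting passes through `c⁻¹`, `s•`, `c`, and back since `c⁻¹(Ψ u) = s•X_u`, `s ≠ 0`, `c(X_u) = g`).
* (R) `separable_charpoly_cayleyScaling_iff` — `χ_{Ψ u}` separable ⟺ `χ_u` separable (★ p855173 `separable_charpoly_cayley_iff` ∕ `…_smul_iff`).
* (C) `inverseWindow_cayleyScaling` (`c⁻¹(Ψ u) = s•X_u`), `cayleyScaling_mem_of_ball` (`Ψ u` lies in every ball of radius `≥ ‖s‖ρ`, in particular in `B`).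
* (T) `iterate_cayleyScaling` (`Ψ^k u ∈ B`, `mat(Ψ^k u) = c(s^k•X_u)`), `tendsto_iterate_cayleyScaling` (`Ψ^k u → 1`, `‖s‖ < 1`; ★ p855173 `tendsto_inv_of_tendsto_one`).
* `continuousOn_cayleyScaling` (`Ψ` is continuous on `B`), `cayleyScaling_left_inv` (the scaling `Θ` by `s⁻¹` on the contracted ball inverts `Ψ` on `B`).
* (S) `isLocSmooth_indicator_comp_cayleyScaling` — for `F ∈ C_c^∞(M)`, `1_B·(F ∘ Ψ) ∈ C_c^∞(M)`: locally constant since `B` is clopen and `Ψ` continuous on it; compactly supported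
  since its support lies in `Θ(tsupp F ∩ B′)`, `B′` the (closed) contracted ball, `Θ` continuous there.
Part 4 (`K2E3CayleyScalingPackage`) transports to `Gqs L v = U(Φ₃)(L⁺_v)` and assembles ‹SC-explicit› → ‹Ψ-package›.

HONEST LABEL.  HC_CM is proved only modulo the 7 printed citations (2 remaining named inputs: hLiu418 = `stmt-HodgeConjecture-24832`, h413 =
`stmt-HodgeConjecture-24833`) until rung 0 closes; this file is a count-neutral helper of the U3-d line.

## References
* [PlatonovRapinchuk1994] V. Platonov, A. Rapinchuk, *Algebraic Groups and Number Theory* (1994), §3.3 (Cayley parametrisation; congruence neighbourhoods).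
* [HarishChandra1999AdmissibleDistributions] Harish-Chandra, *Admissible Invariant Distributions on Reductive p-adic Groups*, ULS 16 (1999), §3.1 Lemma 3.2.
* [Rogawski1990] J. D. Rogawski, *Automorphic Representations of Unitary Groups in Three Variables*, Ann. of Math. Stud. 123 (1990), §8.1 Prop. 8.1.2 (b) p. 114.
-/

set_option autoImplicit false
-- the mandated namespace repeats the single-problem summit's segment (`HodgeConjecture.HodgeConjecture`), as in every `Theorems/*.lean` of this sub-problem
set_option linter.dupNamespace false

noncomputable section

open Filter Topology Polynomial Set
open scoped Matrix MatrixGroups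
open Literature.NumberTheory.Automorphic Literature.NumberTheory.Rogawski1990 Literature.NumberTheory.Weil1982.UnitaryFinTopForm Literature.LinearAlgebra.Matrix
open Summit.HodgeConjecture.HodgeConjecture.Cruxes.H413.K2E3CompactCartanRegularRay
open Summit.HodgeConjecture.HodgeConjecture.Cruxes.H413.K2E3CayleyScalingAlgebra
open Summit.HodgeConjecture.HodgeConjecture.Cruxes.H413.K2E3CayleyScalingModel

namespace Summit.HodgeConjecture.HodgeConjecture.Cruxes.H413.K2E3CayleyScalingMap

section Model

variable {K : Type*} [NormedField K] [IsUltrametricDist K] (σ : K →+* K) (J : Matrix (Fin 3) (Fin 3) K) {ρ : ℝ} {s : K}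
  {B : Set ↥(unitaryGroupOfForm σ J)}
  (hB : ∀ u : ↥(unitaryGroupOfForm σ J), u ∈ B ↔
    IsUnit (((u : GL (Fin 3) K) : Matrix (Fin 3) (Fin 3) K) + 1).det ∧
    ‖((((u : GL (Fin 3) K) : Matrix (Fin 3) (Fin 3) K) - 1) * (((u : GL (Fin 3) K) : Matrix (Fin 3) (Fin 3) K) + 1)⁻¹).charpoly.coeff 2‖ ≤ ρ ∧
    ‖((((u : GL (Fin 3) K) : Matrix (Fin 3) (Fin 3) K) - 1) * (((u : GL (Fin 3) K) : Matrix (Fin 3) (Fin 3) K) + 1)⁻¹).charpoly.coeff 1‖ ≤ ρ ^ 2 ∧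
    ‖((((u : GL (Fin 3) K) : Matrix (Fin 3) (Fin 3) K) - 1) * (((u : GL (Fin 3) K) : Matrix (Fin 3) (Fin 3) K) + 1)⁻¹).charpoly.coeff 0‖ ≤ ρ ^ 3)
  {Ψ : ↥(unitaryGroupOfForm σ J) → ↥(unitaryGroupOfForm σ J)}
  (hΨ : ∀ u ∈ B,
    (((Ψ u : ↥(unitaryGroupOfForm σ J)) : GL (Fin 3) K) : Matrix (Fin 3) (Fin 3) K) =
        cayley (s • ((((u : GL (Fin 3) K) : Matrix (Fin 3) (Fin 3) K) - 1) * (((u : GL (Fin 3) K) : Matrix (Fin 3) (Fin 3) K) + 1)⁻¹)) ∧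
    ((((Ψ u : ↥(unitaryGroupOfForm σ J)) : GL (Fin 3) K)⁻¹ : GL (Fin 3) K) : Matrix (Fin 3) (Fin 3) K) =
        cayley (-(s • ((((u : GL (Fin 3) K) : Matrix (Fin 3) (Fin 3) K) - 1) * (((u : GL (Fin 3) K) : Matrix (Fin 3) (Fin 3) K) + 1)⁻¹))))

omit [IsUltrametricDist K] in
/-- Matrices of products and inverses in `U(σ, J)(K)`. [folklore] -/
theorem coe_mul_coe (x y : ↥(unitaryGroupOfForm σ J)) :
    (((x * y : ↥(unitaryGroupOfForm σ J)) : GL (Fin 3) K) : Matrix (Fin 3) (Fin 3) K) =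
      ((x : GL (Fin 3) K) : Matrix (Fin 3) (Fin 3) K) * ((y : GL (Fin 3) K) : Matrix (Fin 3) (Fin 3) K) := by
  simp only [Subgroup.coe_mul, Units.val_mul]

omit [IsUltrametricDist K] in
/-- Matrices of conjugates in `U(σ, J)(K)`. [folklore] -/
theorem coe_conj (x u : ↥(unitaryGroupOfForm σ J)) :
    (((x * u * x⁻¹ : ↥(unitaryGroupOfForm σ J)) : GL (Fin 3) K) : Matrix (Fin 3) (Fin 3) K) =
      ((x : GL (Fin 3) K) : Matrix (Fin 3) (Fin 3) K) * ((u : GL (Fin 3) K) : Matrix (Fin 3) (Fin 3) K) * (((x : GL (Fin 3) K)⁻¹ : GL (Fin 3) K) : Matrix (Fin 3) (Fin 3) K) := by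
  simp only [Subgroup.coe_mul, Subgroup.coe_inv, Units.val_mul]

omit [IsUltrametricDist K] in
/-- Two elements of `U(σ, J)(K)` commute iff their matrices do. [folklore] -/
theorem commute_iff_coe (z u : ↥(unitaryGroupOfForm σ J)) :
    z * u = u * z ↔ ((z : GL (Fin 3) K) : Matrix (Fin 3) (Fin 3) K) * ((u : GL (Fin 3) K) : Matrix (Fin 3) (Fin 3) K) =
      ((u : GL (Fin 3) K) : Matrix (Fin 3) (Fin 3) K) * ((z : GL (Fin 3) K) : Matrix (Fin 3) (Fin 3) K) := by
  rw [← coe_mul_coe, ← coe_mul_coe]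
  exact ⟨fun h => by rw [h], fun h => Subtype.ext (Units.ext h)⟩

/-! ## (C) The scaled element: `c⁻¹(Ψ u) = s•X_u`, and `Ψ u` lies in every ball of radius `≥ ‖s‖ρ` -/

include hB hΨ in
/-- **`c⁻¹(Ψ u) = s • X_u`** with `det(Ψ u + 1)` a unit (`Ψ u = c(s•X_u)`; ★ `inverseWindow_cayley`, ★ `isUnit_det_cayley_add_one`). [cite: PlatonovRapinchuk1994, §3.3] -/
theorem inverseWindow_cayleyScaling (h2 : (2 : K) ≠ 0) (hsρ : ‖s‖ * ρ < 1) {u : ↥(unitaryGroupOfForm σ J)} (hu : u ∈ B) :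
    IsUnit ((((Ψ u : ↥(unitaryGroupOfForm σ J)) : GL (Fin 3) K) : Matrix (Fin 3) (Fin 3) K) + 1).det ∧
    ((((Ψ u : ↥(unitaryGroupOfForm σ J)) : GL (Fin 3) K) : Matrix (Fin 3) (Fin 3) K) - 1) * ((((Ψ u : ↥(unitaryGroupOfForm σ J)) : GL (Fin 3) K) : Matrix (Fin 3) (Fin 3) K) + 1)⁻¹ =
      s • ((((u : GL (Fin 3) K) : Matrix (Fin 3) (Fin 3) K) - 1) * (((u : GL (Fin 3) K) : Matrix (Fin 3) (Fin 3) K) + 1)⁻¹) := by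
  obtain ⟨-, hm, -⟩ := isUnit_of_mem_ball σ J hB hsρ hu
  have h2u : IsUnit (2 : K) := isUnit_iff_ne_zero.2 h2
  rw [(hΨ u hu).1]
  exact ⟨isUnit_det_cayley_add_one h2u hm, inverseWindow_cayley h2u hm⟩

include hB hΨ in
/-- **(C) `Ψ u` lies in every eigenvalue ball of radius `ρ′ ≥ ‖s‖ρ`** (its inverse Cayley transform is `s•X_u`, whose coefficients obey the bounds with `‖s‖ρ`); with `ρ′ = ρ`
(`‖s‖ ≤ 1`): `Ψ B ⊆ B`. [cite: HarishChandra1999AdmissibleDistributions, §3.1 Lemma 3.2] [cite: PlatonovRapinchuk1994, §3.3] -/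
theorem cayleyScaling_mem_of_ball (h2 : (2 : K) ≠ 0) (hsρ : ‖s‖ * ρ < 1) {ρ' : ℝ} (hρ' : ‖s‖ * ρ ≤ ρ')
    {B' : Set ↥(unitaryGroupOfForm σ J)}
    (hB' : ∀ u : ↥(unitaryGroupOfForm σ J), u ∈ B' ↔
      IsUnit (((u : GL (Fin 3) K) : Matrix (Fin 3) (Fin 3) K) + 1).det ∧
      ‖((((u : GL (Fin 3) K) : Matrix (Fin 3) (Fin 3) K) - 1) * (((u : GL (Fin 3) K) : Matrix (Fin 3) (Fin 3) K) + 1)⁻¹).charpoly.coeff 2‖ ≤ ρ' ∧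
      ‖((((u : GL (Fin 3) K) : Matrix (Fin 3) (Fin 3) K) - 1) * (((u : GL (Fin 3) K) : Matrix (Fin 3) (Fin 3) K) + 1)⁻¹).charpoly.coeff 1‖ ≤ ρ' ^ 2 ∧
      ‖((((u : GL (Fin 3) K) : Matrix (Fin 3) (Fin 3) K) - 1) * (((u : GL (Fin 3) K) : Matrix (Fin 3) (Fin 3) K) + 1)⁻¹).charpoly.coeff 0‖ ≤ ρ' ^ 3)
    {u : ↥(unitaryGroupOfForm σ J)} (hu : u ∈ B) : Ψ u ∈ B' := by
  obtain ⟨hP', hX'⟩ := inverseWindow_cayleyScaling σ J hB hΨ h2 hsρ hu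
  obtain ⟨-, hc2, hc1, hc0⟩ := (hB u).1 hu
  obtain ⟨e2, e1, e0⟩ := coeff_ball_smul s hc2 hc1 hc0
  have h0 : 0 ≤ ‖s‖ * ρ := mul_nonneg (norm_nonneg _) ((norm_nonneg _).trans hc2)
  rw [hB', hX']
  exact ⟨hP', e2.trans hρ', e1.trans (pow_le_pow_left₀ h0 hρ' 2), e0.trans (pow_le_pow_left₀ h0 hρ' 3)⟩

/-! ## (E) Equivariance -/

include hB hΨ in
/-- **(E) `Ψ(x u x⁻¹) = x Ψ(u) x⁻¹`** for `u ∈ B`, `x ∈ U(σ, J)(K)` (★ `inverseWindow_conj`, ★ `cayley_conj`; `B` is Ad-stable, ★ `conj_mem_ball`). [cite: PlatonovRapinchuk1994, §3.3] -/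
theorem cayleyScaling_conj (hsρ : ‖s‖ * ρ < 1) {u : ↥(unitaryGroupOfForm σ J)} (hu : u ∈ B) (x : ↥(unitaryGroupOfForm σ J)) :
    Ψ (x * u * x⁻¹) = x * Ψ u * x⁻¹ := by
  have hxu : x * u * x⁻¹ ∈ B := conj_mem_ball σ J hB hu x
  obtain ⟨hP, hm, -⟩ := isUnit_of_mem_ball σ J hB hsρ hu
  apply Subtype.ext; apply Units.ext
  rw [(hΨ _ hxu).1, coe_conj, coe_conj, inverseWindow_conj (x : GL (Fin 3) K) hP, (hΨ u hu).1, ← cayley_conj (x : GL (Fin 3) K) hm, Matrix.mul_smul,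
    Matrix.smul_mul]

/-! ## (Z) Centralisers -/

include hB hΨ in
/-- **(Z) `z u = u z ⟺ z Ψ(u) = Ψ(u) z`** for `u ∈ B` (`s ≠ 0`, `2 ≠ 0`): anything commuting with `g` commutes with `X_u = c⁻¹(g)` (★ `inverseWindow_comm_of_comm`), with `s•X_u` and
with `c(s•X_u) = Ψ u` (★ `cayley_comm_of_comm`); conversely anything commuting with `Ψ u` commutes with `c⁻¹(Ψ u) = s•X_u` (★ `inverseWindow_cayley`), hence with `X_u`
(`s ≠ 0`) and with `c(X_u) = g` (★ `cayley_inverseWindow`).  So `Z(Ψ u) = Z(u)`. [cite: PlatonovRapinchuk1994, §3.3] [cite: Rogawski1990, §3.1 p. 19] -/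
theorem comm_iff_comm_cayleyScaling (h2 : (2 : K) ≠ 0) (hs0 : s ≠ 0) (hsρ : ‖s‖ * ρ < 1) {u : ↥(unitaryGroupOfForm σ J)} (hu : u ∈ B)
    (z : ↥(unitaryGroupOfForm σ J)) : z * u = u * z ↔ z * Ψ u = Ψ u * z := by
  obtain ⟨hP, hm, -⟩ := isUnit_of_mem_ball σ J hB hsρ hu
  have h2u : IsUnit (2 : K) := isUnit_iff_ne_zero.2 h2
  obtain ⟨hm₀, hcay₀⟩ := cayley_inverseWindow h2u hP
  set g := ((u : GL (Fin 3) K) : Matrix (Fin 3) (Fin 3) K) with hg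
  set Z := ((z : GL (Fin 3) K) : Matrix (Fin 3) (Fin 3) K) with hZ
  set X₀ := (g - 1) * (g + 1)⁻¹ with hX₀
  rw [commute_iff_coe, commute_iff_coe, (hΨ u hu).1]
  constructor
  · intro hzg
    have hX : X₀ * Z = Z * X₀ := inverseWindow_comm_of_comm hP hzg.symm
    have hsX : s • X₀ * Z = Z * (s • X₀) := by rw [Matrix.smul_mul, Matrix.mul_smul, hX]
    exact (cayley_comm_of_comm hm hsX).symm
  · intro hzc
    have hP' : IsUnit (cayley (s • X₀) + 1).det := isUnit_det_cayley_add_one h2u hm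
    have h1 := inverseWindow_comm_of_comm hP' hzc.symm
    rw [inverseWindow_cayley h2u hm, Matrix.smul_mul, Matrix.mul_smul] at h1
    have hX : X₀ * Z = Z * X₀ := smul_right_injective (Matrix (Fin 3) (Fin 3) K) hs0 h1
    have h3 := cayley_comm_of_comm hm₀ hX
    rw [hcay₀] at h3
    exact h3.symm

/-! ## (R) Regularity -/

include hB hΨ in
/-- **(R) `χ_{Ψ u}` is separable iff `χ_u` is** (`u ∈ B`, `s ≠ 0`, `2 ≠ 0`): `Ψ u = c(s•X_u)`, `u = c(X_u)`, and separability passes through `c` and through `s•` (★ p855173).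
[cite: Rogawski1990, §3.1 p. 19] [cite: PlatonovRapinchuk1994, §3.3] -/
theorem separable_charpoly_cayleyScaling_iff (h2 : (2 : K) ≠ 0) (hs0 : s ≠ 0) (hsρ : ‖s‖ * ρ < 1) {u : ↥(unitaryGroupOfForm σ J)} (hu : u ∈ B) :
    ((((Ψ u : ↥(unitaryGroupOfForm σ J)) : GL (Fin 3) K) : Matrix (Fin 3) (Fin 3) K)).charpoly.Separable ↔
      (((u : GL (Fin 3) K) : Matrix (Fin 3) (Fin 3) K)).charpoly.Separable := by
  obtain ⟨hP, hm, -⟩ := isUnit_of_mem_ball σ J hB hsρ hu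
  have h2u : IsUnit (2 : K) := isUnit_iff_ne_zero.2 h2
  obtain ⟨hm₀, hcay₀⟩ := cayley_inverseWindow h2u hP
  rw [(hΨ u hu).1, separable_charpoly_cayley_iff h2u hm, separable_charpoly_smul_iff (isUnit_iff_ne_zero.2 hs0)]
  conv_rhs => rw [← hcay₀]
  rw [separable_charpoly_cayley_iff h2u hm₀]

/-! ## (T) Iterates: `Ψ^k u = c(s^k • X_u) → 1` -/

include hB hΨ in
/-- **The iterates of `Ψ` on `B`**: `Ψ^k u ∈ B`, `mat(Ψ^k u) = c(s^k•X_u)`, `mat((Ψ^k u)⁻¹) = c(−s^k•X_u)` (`‖s‖ ≤ 1`, `ρ < 1`, `2 ≠ 0`; induction, reading `c⁻¹(c(Y)) = Y` at each step).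
[cite: HarishChandra1999AdmissibleDistributions, §3.1 Lemma 3.2] [cite: PlatonovRapinchuk1994, §3.3] -/
theorem iterate_cayleyScaling (h2 : (2 : K) ≠ 0) (hs1 : ‖s‖ ≤ 1) (hρ : ρ < 1) {u : ↥(unitaryGroupOfForm σ J)} (hu : u ∈ B) (k : ℕ) :
    Ψ^[k] u ∈ B ∧
    (((Ψ^[k] u : ↥(unitaryGroupOfForm σ J)) : GL (Fin 3) K) : Matrix (Fin 3) (Fin 3) K) =
        cayley (s ^ k • ((((u : GL (Fin 3) K) : Matrix (Fin 3) (Fin 3) K) - 1) * (((u : GL (Fin 3) K) : Matrix (Fin 3) (Fin 3) K) + 1)⁻¹)) ∧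
    ((((Ψ^[k] u : ↥(unitaryGroupOfForm σ J)) : GL (Fin 3) K)⁻¹ : GL (Fin 3) K) : Matrix (Fin 3) (Fin 3) K) =
        cayley (-(s ^ k • ((((u : GL (Fin 3) K) : Matrix (Fin 3) (Fin 3) K) - 1) * (((u : GL (Fin 3) K) : Matrix (Fin 3) (Fin 3) K) + 1)⁻¹))) := by
  have hρ0 : 0 ≤ ρ := by obtain ⟨-, hc2, -, -⟩ := (hB u).1 hu; exact (norm_nonneg _).trans hc2
  have hsρ : ‖s‖ * ρ < 1 := lt_of_le_of_lt (mul_le_of_le_one_left hρ0 hs1) hρ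
  have h2u : IsUnit (2 : K) := isUnit_iff_ne_zero.2 h2
  induction k with
  | zero =>
    obtain ⟨hP, hm1, hp1⟩ := isUnit_of_mem_ball σ J hB (s := (1 : K)) (by rw [norm_one, one_mul]; exact hρ) hu
    rw [one_smul] at hm1 hp1
    obtain ⟨-, hcay₀⟩ := cayley_inverseWindow h2u hP
    refine ⟨hu, ?_, ?_⟩
    · rw [Function.iterate_zero_apply, pow_zero, one_smul]
      exact hcay₀.symm
    · rw [Function.iterate_zero_apply, pow_zero, one_smul, Matrix.coe_units_inv]
      conv_lhs => rw [← hcay₀]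
      exact Matrix.inv_eq_right_inv (cayley_mul_cayley_neg hm1 hp1)
  | succ k ih =>
    obtain ⟨hk, hmat, -⟩ := ih
    have hsk : ‖s ^ k‖ * ρ < 1 := lt_of_le_of_lt (mul_le_of_le_one_left hρ0 (by rw [norm_pow]; exact pow_le_one₀ (norm_nonneg _) hs1)) hρ
    obtain ⟨-, hmk, -⟩ := isUnit_of_mem_ball σ J hB hsk hu
    have hXk : ((((Ψ^[k] u : ↥(unitaryGroupOfForm σ J)) : GL (Fin 3) K) : Matrix (Fin 3) (Fin 3) K) - 1) *
        ((((Ψ^[k] u : ↥(unitaryGroupOfForm σ J)) : GL (Fin 3) K) : Matrix (Fin 3) (Fin 3) K) + 1)⁻¹ =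
        s ^ k • ((((u : GL (Fin 3) K) : Matrix (Fin 3) (Fin 3) K) - 1) * (((u : GL (Fin 3) K) : Matrix (Fin 3) (Fin 3) K) + 1)⁻¹) := by
      rw [hmat]; exact inverseWindow_cayley h2u hmk
    rw [Function.iterate_succ_apply']
    refine ⟨cayleyScaling_mem_of_ball σ J hB hΨ h2 hsρ (mul_le_of_le_one_left hρ0 hs1) hB hk, ?_, ?_⟩
    · rw [(hΨ _ hk).1, hXk, smul_smul, ← pow_succ']
    · rw [(hΨ _ hk).2, hXk, smul_smul, ← pow_succ']

include hB hΨ in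
/-- **(T) `Ψ^k u → 1`** for `u ∈ B` (`‖s‖ < 1`): `mat(Ψ^k u) = c(s^k•X_u) → c(0) = 1` and likewise for the inverses, in the `GL`-topology (★ p855173 `tendsto_pow_smul`,
`tendsto_inv_of_tendsto_one`, Mathlib `Units.isEmbedding_embedProduct`). [cite: Rogawski1990, §8.1 (8.1.1) p. 116] [cite: HarishChandra1999AdmissibleDistributions, §3.1 Lemma 3.2] -/
theorem tendsto_iterate_cayleyScaling (h2 : (2 : K) ≠ 0) (hs1 : ‖s‖ < 1) (hρ : ρ < 1) {u : ↥(unitaryGroupOfForm σ J)} (hu : u ∈ B) :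
    Tendsto (fun k : ℕ => Ψ^[k] u) atTop (𝓝 1) := by
  set X₀ := ((((u : GL (Fin 3) K) : Matrix (Fin 3) (Fin 3) K) - 1) * (((u : GL (Fin 3) K) : Matrix (Fin 3) (Fin 3) K) + 1)⁻¹) with hX₀
  have hiter := fun k => iterate_cayleyScaling σ J hB hΨ h2 hs1.le hρ hu k
  have hY : Tendsto (fun k : ℕ => s ^ k • X₀) atTop (𝓝 0) := tendsto_pow_smul hs1 X₀
  have hcay : Tendsto (fun k : ℕ => cayley (s ^ k • X₀)) atTop (𝓝 1) := by
    have ha : Tendsto (fun k : ℕ => 1 + s ^ k • X₀) atTop (𝓝 1) := by simpa using tendsto_const_nhds.add hY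
    have hb : Tendsto (fun k : ℕ => (1 - s ^ k • X₀)⁻¹) atTop (𝓝 1) := tendsto_inv_of_tendsto_one (by simpa using tendsto_const_nhds.sub hY)
    simpa [cayley_def] using ha.mul hb
  have hcay' : Tendsto (fun k : ℕ => cayley (-(s ^ k • X₀))) atTop (𝓝 1) := by
    have ha : Tendsto (fun k : ℕ => 1 + -(s ^ k • X₀)) atTop (𝓝 1) := by simpa using tendsto_const_nhds.add hY.neg
    have hb : Tendsto (fun k : ℕ => (1 - -(s ^ k • X₀))⁻¹) atTop (𝓝 1) := tendsto_inv_of_tendsto_one (by simpa using tendsto_const_nhds.sub hY.neg)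
    simpa [cayley_def] using ha.mul hb
  rw [tendsto_subtype_rng, Units.isEmbedding_embedProduct.isInducing.tendsto_nhds_iff]
  have h1 : Units.embedProduct (Matrix (Fin 3) (Fin 3) K) ((1 : ↥(unitaryGroupOfForm σ J)) : GL (Fin 3) K) =
      ((1 : Matrix (Fin 3) (Fin 3) K), MulOpposite.op (1 : Matrix (Fin 3) (Fin 3) K)) := by simp
  rw [h1]
  refine (hcay.prodMk_nhds ((MulOpposite.continuous_op.tendsto 1).comp hcay')).congr' (Eventually.of_forall fun k => ?_)
  show (cayley (s ^ k • X₀), MulOpposite.op (cayley (-(s ^ k • X₀)))) = Units.embedProduct _ ((Ψ^[k] u : ↥(unitaryGroupOfForm σ J)) : GL (Fin 3) K)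
  rw [Units.embedProduct_apply, (hiter k).2.1, (hiter k).2.2]

/-! ## Continuity on the ball and the left inverse -/

include hB hΨ in
/-- **`Ψ` is continuous on `B`** (in the `GL`-topology of `U(σ, J)(K)`): on `B` it is `u ↦ (c(s•X_u), c(−s•X_u))` through `g ↦ (g, g⁻¹)`, a composition of ring operations and
inversions at invertible matrices (★ part 2). [cite: PlatonovRapinchuk1994, §3.3] -/
theorem continuousOn_cayleyScaling (hsρ : ‖s‖ * ρ < 1) : ContinuousOn Ψ B := by
  intro u hu
  obtain ⟨hP, hm, hp⟩ := isUnit_of_mem_ball σ J hB hsρ hu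
  have hm' : (1 - (-s) • ((((u : GL (Fin 3) K) : Matrix (Fin 3) (Fin 3) K) - 1) * (((u : GL (Fin 3) K) : Matrix (Fin 3) (Fin 3) K) + 1)⁻¹)).det ≠ 0 := by
    rw [neg_smul, sub_neg_eq_add]; exact hp.ne_zero
  -- the explicit pair map is continuous at `u`
  have hF1 := ((continuousAt_cayley_smul_inverseWindow s hP.ne_zero hm.ne_zero).tendsto).comp ((continuous_coe_mat σ J).tendsto u)
  have hF2 := (MulOpposite.continuous_op.tendsto _).comp
    (((continuousAt_cayley_smul_inverseWindow (-s) hP.ne_zero hm').tendsto).comp ((continuous_coe_mat σ J).tendsto u))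
  have hF := (hF1.prodMk_nhds hF2).mono_left (nhdsWithin_le_nhds (s := B))
  -- read `Ψ` through the inducing map `g ↦ (g, g⁻¹)`
  have heq : ∀ u' ∈ B, Units.embedProduct (Matrix (Fin 3) (Fin 3) K) ((Ψ u' : ↥(unitaryGroupOfForm σ J)) : GL (Fin 3) K) =
      (cayley (s • ((((u' : GL (Fin 3) K) : Matrix (Fin 3) (Fin 3) K) - 1) * (((u' : GL (Fin 3) K) : Matrix (Fin 3) (Fin 3) K) + 1)⁻¹)),
        MulOpposite.op (cayley ((-s) • ((((u' : GL (Fin 3) K) : Matrix (Fin 3) (Fin 3) K) - 1) * (((u' : GL (Fin 3) K) : Matrix (Fin 3) (Fin 3) K) + 1)⁻¹)))) :=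
    fun u' hu' => by rw [Units.embedProduct_apply, (hΨ u' hu').1, (hΨ u' hu').2, neg_smul]
  rw [ContinuousWithinAt, tendsto_subtype_rng, Units.isEmbedding_embedProduct.isInducing.tendsto_nhds_iff, heq u hu]
  refine hF.congr' ?_
  filter_upwards [self_mem_nhdsWithin] with u' hu'
  exact (heq u' hu').symm

include hB hΨ in
/-- **The scaling by `s⁻¹` inverts `Ψ` on `B`**: if `Θ` agrees with `c ∘ (s⁻¹·) ∘ c⁻¹` on a ball `B′` of radius `ρ′ ≥ ‖s‖ρ` (which contains `Ψ B`), then `Θ(Ψ u) = u` for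
`u ∈ B` (`c⁻¹(Ψ u) = s•X_u`, `s⁻¹•s•X_u = X_u`, `c(X_u) = g`). [cite: PlatonovRapinchuk1994, §3.3] -/
theorem cayleyScaling_left_inv (h2 : (2 : K) ≠ 0) (hs0 : s ≠ 0) (hsρ : ‖s‖ * ρ < 1) {ρ' : ℝ} (hρ' : ‖s‖ * ρ ≤ ρ')
    {B' : Set ↥(unitaryGroupOfForm σ J)}
    (hB' : ∀ u : ↥(unitaryGroupOfForm σ J), u ∈ B' ↔
      IsUnit (((u : GL (Fin 3) K) : Matrix (Fin 3) (Fin 3) K) + 1).det ∧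
      ‖((((u : GL (Fin 3) K) : Matrix (Fin 3) (Fin 3) K) - 1) * (((u : GL (Fin 3) K) : Matrix (Fin 3) (Fin 3) K) + 1)⁻¹).charpoly.coeff 2‖ ≤ ρ' ∧
      ‖((((u : GL (Fin 3) K) : Matrix (Fin 3) (Fin 3) K) - 1) * (((u : GL (Fin 3) K) : Matrix (Fin 3) (Fin 3) K) + 1)⁻¹).charpoly.coeff 1‖ ≤ ρ' ^ 2 ∧
      ‖((((u : GL (Fin 3) K) : Matrix (Fin 3) (Fin 3) K) - 1) * (((u : GL (Fin 3) K) : Matrix (Fin 3) (Fin 3) K) + 1)⁻¹).charpoly.coeff 0‖ ≤ ρ' ^ 3)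
    {Θ : ↥(unitaryGroupOfForm σ J) → ↥(unitaryGroupOfForm σ J)}
    (hΘ : ∀ u ∈ B',
      (((Θ u : ↥(unitaryGroupOfForm σ J)) : GL (Fin 3) K) : Matrix (Fin 3) (Fin 3) K) =
        cayley (s⁻¹ • ((((u : GL (Fin 3) K) : Matrix (Fin 3) (Fin 3) K) - 1) * (((u : GL (Fin 3) K) : Matrix (Fin 3) (Fin 3) K) + 1)⁻¹)))
    {u : ↥(unitaryGroupOfForm σ J)} (hu : u ∈ B) : Θ (Ψ u) = u := by
  have hmem : Ψ u ∈ B' := cayleyScaling_mem_of_ball σ J hB hΨ h2 hsρ hρ' hB' hu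
  obtain ⟨hP, -, -⟩ := isUnit_of_mem_ball σ J hB hsρ hu
  obtain ⟨-, hcay₀⟩ := cayley_inverseWindow (isUnit_iff_ne_zero.2 h2) hP
  obtain ⟨-, hX'⟩ := inverseWindow_cayleyScaling σ J hB hΨ h2 hsρ hu
  apply Subtype.ext; apply Units.ext
  rw [hΘ _ hmem, hX', smul_smul, inv_mul_cancel₀ hs0, one_smul, hcay₀]

/-! ## (S) `1_B · (F ∘ Ψ)` is locally constant and compactly supported -/

include hB hΨ in
/-- **(S) `Ψ` PULLS `C_c^∞` BACK TO `C_c^∞` ON THE BALL**: for `F : U(σ, J)(K) → ℂ` locally constant with compact support, `1_B·(F ∘ Ψ)` is locally constant (`B` is clopen, ★ part 2,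
and `Ψ` is continuous on `B`) and compactly supported (its support lies in `Θ(tsupp F ∩ B′)`, `B′` the closed contracted ball of radius `‖s‖ρ` containing `Ψ B`, `Θ` the
scaling by `s⁻¹`, continuous on `B′` and a left inverse of `Ψ`).  Hypotheses: `2 ≠ 0`, `s ≠ 0`, `‖s‖ ≤ 1`, `0 < ρ < 1`. [cite: Rogawski1990, §8.1 Prop. 8.1.2 (b) p. 114]
[cite: PlatonovRapinchuk1994, §3.3] -/
theorem isLocSmooth_indicator_comp_cayleyScaling (h2 : (2 : K) ≠ 0) (hs0 : s ≠ 0) (hs1 : ‖s‖ ≤ 1) (hρ0 : 0 < ρ) (hρ1 : ρ < 1)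
    {B' : Set ↥(unitaryGroupOfForm σ J)}
    (hB' : ∀ u : ↥(unitaryGroupOfForm σ J), u ∈ B' ↔
      IsUnit (((u : GL (Fin 3) K) : Matrix (Fin 3) (Fin 3) K) + 1).det ∧
      ‖((((u : GL (Fin 3) K) : Matrix (Fin 3) (Fin 3) K) - 1) * (((u : GL (Fin 3) K) : Matrix (Fin 3) (Fin 3) K) + 1)⁻¹).charpoly.coeff 2‖ ≤ ‖s‖ * ρ ∧
      ‖((((u : GL (Fin 3) K) : Matrix (Fin 3) (Fin 3) K) - 1) * (((u : GL (Fin 3) K) : Matrix (Fin 3) (Fin 3) K) + 1)⁻¹).charpoly.coeff 1‖ ≤ (‖s‖ * ρ) ^ 2 ∧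
      ‖((((u : GL (Fin 3) K) : Matrix (Fin 3) (Fin 3) K) - 1) * (((u : GL (Fin 3) K) : Matrix (Fin 3) (Fin 3) K) + 1)⁻¹).charpoly.coeff 0‖ ≤ (‖s‖ * ρ) ^ 3)
    {Θ : ↥(unitaryGroupOfForm σ J) → ↥(unitaryGroupOfForm σ J)}
    (hΘ : ∀ u ∈ B',
      (((Θ u : ↥(unitaryGroupOfForm σ J)) : GL (Fin 3) K) : Matrix (Fin 3) (Fin 3) K) =
          cayley (s⁻¹ • ((((u : GL (Fin 3) K) : Matrix (Fin 3) (Fin 3) K) - 1) * (((u : GL (Fin 3) K) : Matrix (Fin 3) (Fin 3) K) + 1)⁻¹)) ∧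
      ((((Θ u : ↥(unitaryGroupOfForm σ J)) : GL (Fin 3) K)⁻¹ : GL (Fin 3) K) : Matrix (Fin 3) (Fin 3) K) =
          cayley (-(s⁻¹ • ((((u : GL (Fin 3) K) : Matrix (Fin 3) (Fin 3) K) - 1) * (((u : GL (Fin 3) K) : Matrix (Fin 3) (Fin 3) K) + 1)⁻¹))))
    {F : ↥(unitaryGroupOfForm σ J) → ℂ} (hF : IsLocSmooth F) : IsLocSmooth (B.indicator (F ∘ Ψ)) := by
  have hρ0' : 0 ≤ ρ := hρ0.le
  have hsρ : ‖s‖ * ρ < 1 := lt_of_le_of_lt (mul_le_of_le_one_left hρ0' hs1) hρ1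
  have hsρ' : ‖s⁻¹‖ * (‖s‖ * ρ) < 1 := by rwa [norm_inv, ← mul_assoc, inv_mul_cancel₀ (norm_ne_zero_iff.2 hs0), one_mul]
  have hBo : IsOpen B := isOpen_ball σ J hB hρ0
  have hBc : IsClosed B := isClosed_ball σ J hB hρ1 h2
  have hB'c : IsClosed B' := isClosed_ball σ J hB' hsρ h2
  have hΨc : ContinuousOn Ψ B := continuousOn_cayleyScaling σ J hB hΨ hsρ
  have hΘc : ContinuousOn Θ B' := continuousOn_cayleyScaling σ J hB' hΘ hsρ'
  have hlinv : ∀ u ∈ B, Θ (Ψ u) = u := fun u hu => cayleyScaling_left_inv σ J hB hΨ h2 hs0 hsρ le_rfl hB' (fun u' hu' => (hΘ u' hu').1) hu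
  refine ⟨?_, ?_⟩
  · -- locally constant
    rw [IsLocallyConstant.iff_eventually_eq]
    intro u
    by_cases hu : u ∈ B
    · have hV : ∀ᶠ y in 𝓝 (Ψ u), F y = F (Ψ u) := (hF.1.isOpen_fiber (F (Ψ u))).mem_nhds rfl
      have h1 : ∀ᶠ u' in 𝓝[B] u, F (Ψ u') = F (Ψ u) := (hΨc u hu).eventually hV
      rw [hBo.nhdsWithin_eq hu] at h1
      filter_upwards [h1, hBo.mem_nhds hu] with u' h1' h2'
      rw [indicator_of_mem h2', indicator_of_mem hu]
      exact h1'
    · filter_upwards [hBc.isOpen_compl.mem_nhds hu] with u' h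
      rw [indicator_of_notMem h, indicator_of_notMem hu]
  · -- compact support
    have hK : IsCompact (Θ '' (tsupport F ∩ B')) := (hF.2.inter_right hB'c).image_of_continuousOn (hΘc.mono inter_subset_right)
    refine HasCompactSupport.intro hK fun u hu => ?_
    by_contra hne
    have huB : u ∈ B := by
      by_contra h
      exact hne (indicator_of_notMem h _)
    rw [indicator_of_mem huB] at hne
    exact hu ⟨Ψ u, ⟨subset_tsupport _ hne, cayleyScaling_mem_of_ball σ J hB hΨ h2 hsρ le_rfl hB' huB⟩, hlinv u huB⟩

end Model

end Summit.HodgeConjecture.HodgeConjecture.Cruxes.H413.K2E3CayleyScalingMap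

end
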